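import Summits.ValiantsHypothesis.ValiantsHypothesis.Theorems.GrenetZeonDualUnipotentThreeHalvesLongMassNilCoupling
import Summits.ValiantsHypothesis.ValiantsHypothesis.Theorems.GrenetZeonDualUnipotentThreeHalvesSlowCoreCoarsen

/-!
# `GrenetZeon.DualUnipotentThreeHalves` (stmt-ValiantsHypothesis-24318), line `slow_core`: the three UNIVERSAL PRICE CEILINGS of (c) and the
# MASS–INDEX corner (row r0 = desk label (G5); lead val-port-2 g4, memo `Cruxes/DualUnipotentThreeHalves/MEMO-port2g4-generic-component.md` §1; crit-7 g3 V34 §1 (U1)–(U3))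

The registered stub (c) `SlowCore.LongMassSlowLawInv` asks for a whole-pencil certificate `SlowCore.RelCert n b B (c·√n·b)`.  Three certificates exist
for EVERY affine pencil (crit-7 V34 §1, «kernel-trivial; each a one-line Ledger» — here they are, as `SlowCore.RelCert` providers by name):
* (U1) FREEZE `relCert_freeze` — `K = ker(lin B)` (the freezing space of ALL positions), window `0`: price `μ := n² − dim ker(lin B)` (the MASS, the rank
  of the linear part; `mass`).  Sharper than ✓ `…IrreducibilityIsFree.relCert_freeze_all` (price `b²`).
* (U2) ABSORB `relCert_absorb` — `K = ⊤`, window `H − 1` when every VALUE `B(y)` satisfies `B(y)^H = 0` [H = the POINTWISE nil-index of the value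
  space; equivalently `B^H = 0` as a matrix over the polynomial ring, `relCert_absorb_of_pow_eq_zero`]: price `n·(H − 1)` (`pow_lineSubst_eq_zero`:
  the pointwise identity `B(y)^H = 0` holds along every line `x + s·v` as a polynomial identity — ✓ `MvPolynomial.funext`; lower powers have degree
  `≤ p ≤ H − 1` by ✓ `SlowCore.totalDegree_pow_apply_le`).
* (U3) WINDOW CAP `relCert_windowCap` — `K = ⊤`, window `n − 1`: price `n·(n − 1)` (the Ledger only looks at powers `≤ n − 1`).
* ★ `relCert_of_mass_mul_index_le` — THE MASS–INDEX CORNER: `μ · (n·(H−1)) ≤ P²  ⇒  RelCert n b B P` (since `min(μ, n(H−1))² ≤ μ·n(H−1)`), and its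
  (c)-shaped reading `relCert_sqrt_of_mass_mul_index_le`: `μ·(H−1) ≤ C·b²  ⇒  RelCert n b B (c·(√n·b))` for every `c` with `C·n ≤ (c·√n)²`
  (e.g. `c² ≥ 4C`, `n ≥ 4`, using `n ≤ (Nat.sqrt n + 1)²`... stated with the explicit arithmetic hypothesis, no hidden constants).
So (c) can only fail on families that are simultaneously DENSE and LONG: `μ_b·H_b / b² → ∞` — the memo's §2 shows such IRREDUCIBLE nil families exist
(`W_{m,s} = M_m ⊗ 𝒮^hi_s ⊕ ℂ(I_m ⊗ J_sᵀ)`, `μ ≈ b²/8`, `H = b/m`) and §3 that they are nevertheless cheap (price `2n+1`), so this file closes a CORNER, not (c).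

WORDS OF RECORD: «row r0 — the universal ceilings U1/U2/U3 and the mass–index corner of (c) in `SlowCore.RelCert` currency; SUPPORT LEMMAS of the
mass-cut line (`--supports stmt-ValiantsHypothesis-24318 --as helper`); NOT progress on (c) `LongMassSlowLawInv` (RESEARCH — OPEN)».
(c) / S3 `SlowPlane` / R2ᵖ / 24318 / 8062 OPEN; `VP ≠ VNP` NOT proved.  No `sorry`, no definitions except the abbreviation `mass` (a natural number).
-/

-- single-conjunct layout: Sub = Summit, duplicated namespace component intended (the name is mandated)
set_option linter.dupNamespace false
set_option autoImplicit false

noncomputable section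

namespace Summit.ValiantsHypothesis.ValiantsHypothesis.Theorems.GrenetZeon.Ceilings

open MvPolynomial Matrix
open scoped BigOperators
open Summit.ValiantsHypothesis.ValiantsHypothesis.Cruxes.TwoDimCoefficients.DimTwoCases (AffMat IsAffine)
open Summit.ValiantsHypothesis.ValiantsHypothesis.Theorems.GrenetZeon.RadicalSplit (lineSubst)
open Summit.ValiantsHypothesis.ValiantsHypothesis.Theorems.GrenetZeon.SlowCore
  (Ledger RelCert Freezes linEntry freezeSpace totalDegree_lineSubst_le_one totalDegree_pow_apply_le lineSubst_apply_of_le_one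
   linEntry_eq_zero_of_mem_freezeSpace codim_freezeSpace_le finrank_dir_le)
open Summit.ValiantsHypothesis.ValiantsHypothesis.Theorems.GrenetZeon.NilCouplingRow (eval_lineSubst)

variable {n m : ℕ}

/-! ## §1 (U3) the window cap and the affine degree bound along lines -/

/-- Along any line, the pull-back of an affine pencil has affine entries (degree `≤ 1` in `s`). -/
theorem isAffine_map_lineSubst (N : AffMat n m) (hN : IsAffine N) (x v : Fin n × Fin n → ℂ) (i j : Fin m) :
    ((N.map (lineSubst x v)) i j).totalDegree ≤ 1 := by
  rw [Matrix.map_apply]; exact totalDegree_lineSubst_le_one x v (hN i j)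

/-- **(U3) WINDOW CAP.**  Every affine pencil carries the whole-pencil ledger `(⊤, n − 1)`: the Ledger only inspects powers `p ≤ n − 1`, whose
entries have `s`-degree `≤ p`.  Price `n·(n−1)`. [crit-7 V34 §1 (U3)] -/
theorem relCert_windowCap (N : AffMat n m) (hN : IsAffine N) : RelCert n m N (n * (n - 1)) := by
  refine ⟨⊤, n - 1, fun x v _ b hb i j _ _ => (totalDegree_pow_apply_le _ (isAffine_map_lineSubst N hN x v) b i j).trans hb, ?_⟩
  rw [finrank_top, Module.finrank_pi, Fintype.card_prod, Fintype.card_fin]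
  omega

/-! ## §2 (U2) absorb: pointwise nil-index ⇒ line nil-index ⇒ window `H − 1` on `K = ⊤` -/

/-- **POINTWISE ⇒ ALONG LINES for powers.**  If every value satisfies `B(y)^H = 0`, then so does every line pull-back `B(x + s·v)`, as a
polynomial matrix identity in `s` (✓ `MvPolynomial.funext`, ℂ infinite). [folklore] -/
theorem pow_lineSubst_eq_zero (N : AffMat n m) {H : ℕ} (hH : ∀ y : Fin n × Fin n → ℂ, (N.map (eval y)) ^ H = 0)
    (x v : Fin n × Fin n → ℂ) : (N.map (lineSubst x v)) ^ H = 0 := by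
  refine Matrix.ext fun r c => ?_
  apply MvPolynomial.funext
  intro t
  rw [Matrix.zero_apply, map_zero]
  have hmap : eval t (((N.map (lineSubst x v)) ^ H) r c) = (((N.map (lineSubst x v)).map (eval t)) ^ H) r c := by
    rw [← Matrix.map_pow, Matrix.map_apply]
  have hval : (N.map (lineSubst x v)).map (eval t) = N.map (eval fun d => x d + t 0 * v d) := by
    rw [Matrix.map_map]
    ext p q
    rw [Matrix.map_apply, Matrix.map_apply, Function.comp_apply, eval_lineSubst]
  rw [hmap, hval, hH]
  rfl

/-- **(U2) ABSORB.**  If every value `B(y)` has `B(y)^H = 0`, the whole-pencil ledger `(⊤, H − 1)` holds: powers `≥ H` vanish along every line and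
lower powers have degree `≤ p ≤ H − 1`.  Price `n·(H − 1)`. [crit-7 V34 §1 (U2)] -/
theorem relCert_absorb (N : AffMat n m) (hN : IsAffine N) {H : ℕ} (hH : ∀ y : Fin n × Fin n → ℂ, (N.map (eval y)) ^ H = 0) :
    RelCert n m N (n * (H - 1)) := by
  refine ⟨⊤, H - 1, fun x v _ b _ i j _ _ => ?_, ?_⟩
  · by_cases hb : b < H
    · exact (totalDegree_pow_apply_le _ (isAffine_map_lineSubst N hN x v) b i j).trans (by omega)
    · have hz : (N.map (lineSubst x v)) ^ b = 0 := by
        rw [show b = H + (b - H) by omega, pow_add, pow_lineSubst_eq_zero N hH x v, zero_mul]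
      rw [hz, Matrix.zero_apply, totalDegree_zero]
      exact Nat.zero_le _
  · rw [finrank_top, Module.finrank_pi, Fintype.card_prod, Fintype.card_fin]
    omega

/-- (U2) from a pencil-level nilpotency `N ^ H = 0` (the form in which the stub's hypothesis `B ^ b = 0` arrives). -/
theorem relCert_absorb_of_pow_eq_zero (N : AffMat n m) (hN : IsAffine N) {H : ℕ} (hH : N ^ H = 0) :
    RelCert n m N (n * (H - 1)) :=
  relCert_absorb N hN fun y => by rw [← Matrix.map_pow, hH]; exact Matrix.map_zero _ (map_zero _)

/-! ## §3 (U1) freeze: price = the MASS `μ` (rank of the linear part) -/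

/-- The **MASS** of an affine pencil: the codimension of the space of directions along which NO entry moves, i.e. the rank of its linear part
(`μ = dim W̄` in crit-7's notation). -/
def mass (N : AffMat n m) : ℕ :=
  n * n - Module.finrank ℂ (freezeSpace N (Finset.univ : Finset (Fin m × Fin m)))

/-- The mass is at most the number of positions `m²` (rank–nullity, ✓ `codim_freezeSpace_le`). -/
theorem mass_le_sq (N : AffMat n m) : mass N ≤ m * m := by
  have h := codim_freezeSpace_le N (Finset.univ : Finset (Fin m × Fin m))
  rw [Finset.card_univ, Fintype.card_prod, Fintype.card_fin] at h
  exact h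

/-- The mass is at most the number of coordinates `n²`. -/
theorem mass_le_coords (N : AffMat n m) : mass N ≤ n * n := Nat.sub_le _ _

/-- Along a direction that freezes every position, the pull-back is the constant matrix `B(x)` (pushed into `ℂ[s]`). -/
theorem map_lineSubst_of_mem_freezeSpace_univ (N : AffMat n m) (hN : IsAffine N) (x v : Fin n × Fin n → ℂ)
    (hv : v ∈ freezeSpace N (Finset.univ : Finset (Fin m × Fin m))) :
    N.map (lineSubst x v) = (N.map (eval x)).map C := by
  ext i j
  rw [Matrix.map_apply, Matrix.map_apply, Matrix.map_apply, lineSubst_apply_of_le_one N hN x v i j,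
    linEntry_eq_zero_of_mem_freezeSpace N _ (Finset.mem_univ (i, j)) hv, map_zero, zero_mul, add_zero]

/-- **(U1) FREEZE.**  The freezing space of all positions carries the whole-pencil ledger with window `0`; price = `mass N`. [crit-7 V34 §1 (U1)] -/
theorem relCert_freeze (N : AffMat n m) (hN : IsAffine N) : RelCert n m N (mass N) := by
  refine ⟨freezeSpace N Finset.univ, 0, fun x v hv b _ i j _ _ => ?_, by rw [mass]; omega⟩
  rw [map_lineSubst_of_mem_freezeSpace_univ N hN x v hv]
  exact (Summit.ValiantsHypothesis.ValiantsHypothesis.Theorems.GrenetZeon.SlowCore.totalDegree_map_C_pow_apply _ b i j).le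

/-! ## §4 The mass–index corner -/

/-- Monotonicity of the price. -/
theorem relCert_mono {N : AffMat n m} {P P' : ℕ} (h : RelCert n m N P) (hP : P ≤ P') : RelCert n m N P' := by
  obtain ⟨K, k, hK, hc⟩ := h
  exact ⟨K, k, hK, hc.trans hP⟩

/-- `min a b ≤ P` as soon as `a·b ≤ P²`. -/
theorem min_le_of_mul_le_sq {a b P : ℕ} (h : a * b ≤ P * P) : min a b ≤ P := by
  by_contra hlt
  push Not at hlt
  have ha : P < a := lt_of_lt_of_le hlt (min_le_left a b)
  have hb : P < b := lt_of_lt_of_le hlt (min_le_right a b)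
  have : P * P < a * b := Nat.mul_lt_mul_of_lt_of_le ha hb.le (by omega)
  omega

/-- ★ **THE MASS–INDEX CORNER.**  If `μ · (n·(H − 1)) ≤ P²` — the mass times the absorb price is at most the square of the budget — then the
cheaper of (U1)/(U2) pays: `RelCert n m N P`.  (memo §1: `min(μ, n(H−1)) ≤ √(μ·n(H−1))`.) -/
theorem relCert_of_mass_mul_index_le (N : AffMat n m) (hN : IsAffine N) {H P : ℕ}
    (hH : ∀ y : Fin n × Fin n → ℂ, (N.map (eval y)) ^ H = 0) (hμ : mass N * (n * (H - 1)) ≤ P * P) :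
    RelCert n m N P := by
  have hmin := min_le_of_mul_le_sq hμ
  by_cases h : mass N ≤ n * (H - 1)
  · exact relCert_mono (relCert_freeze N hN) ((min_eq_left h).symm.le.trans hmin)
  · push Not at h
    exact relCert_mono (relCert_absorb N hN hH) ((min_eq_right h.le).symm.le.trans hmin)

/-- ★ **THE MASS–INDEX CORNER in (c)'s currency.**  If the mass–index product is `≤ C·b²` and the constant `c` satisfies `C·n ≤ (c·√n)²`
(`√n = Nat.sqrt n`; e.g. any `c` with `c² ≥ 4C` once `n ≥ 1`, since `n < (Nat.sqrt n + 1)² ≤ 4·(Nat.sqrt n)²`), then the pencil has the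
certificate the stub (c) asks for: `RelCert n b B (c·(√n·b))`.  So a violator family of (c) must have `μ_b·(H_b − 1)/b² → ∞`. -/
theorem relCert_sqrt_of_mass_mul_index_le (N : AffMat n m) (hN : IsAffine N) {H C c : ℕ}
    (hH : ∀ y : Fin n × Fin n → ℂ, (N.map (eval y)) ^ H = 0) (hμ : mass N * (H - 1) ≤ C * (m * m))
    (hc : C * n ≤ (c * Nat.sqrt n) * (c * Nat.sqrt n)) :
    RelCert n m N (c * (Nat.sqrt n * m)) := by
  apply relCert_of_mass_mul_index_le N hN hH
  have h1 : mass N * (n * (H - 1)) = (mass N * (H - 1)) * n := by ring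
  calc mass N * (n * (H - 1)) = (mass N * (H - 1)) * n := h1
    _ ≤ C * (m * m) * n := Nat.mul_le_mul_right _ hμ
    _ = (C * n) * (m * m) := by ring
    _ ≤ (c * Nat.sqrt n) * (c * Nat.sqrt n) * (m * m) := Nat.mul_le_mul_right _ hc
    _ = c * (Nat.sqrt n * m) * (c * (Nat.sqrt n * m)) := by ring

/-- The same from the pencil-level nilpotency `N ^ H = 0`. -/
theorem relCert_sqrt_of_mass_mul_index_le' (N : AffMat n m) (hN : IsAffine N) {H C c : ℕ} (hH : N ^ H = 0)
    (hμ : mass N * (H - 1) ≤ C * (m * m)) (hc : C * n ≤ (c * Nat.sqrt n) * (c * Nat.sqrt n)) :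
    RelCert n m N (c * (Nat.sqrt n * m)) :=
  relCert_sqrt_of_mass_mul_index_le N hN (fun y => by rw [← Matrix.map_pow, hH]; exact Matrix.map_zero _ (map_zero _)) hμ hc

/-- Arithmetic service lemma for choosing the constant: `C·n ≤ (c·√n)²` whenever `4·C ≤ c²` and `1 ≤ n`. -/
theorem const_ok {C c n : ℕ} (hc : 4 * C ≤ c * c) (hn : 1 ≤ n) : C * n ≤ (c * Nat.sqrt n) * (c * Nat.sqrt n) := by
  have hs : 1 ≤ Nat.sqrt n := Nat.le_sqrt.mpr (by simpa using hn)
  have hlt : n < (Nat.sqrt n + 1) * (Nat.sqrt n + 1) := Nat.lt_succ_sqrt n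
  have h4 : (Nat.sqrt n + 1) * (Nat.sqrt n + 1) ≤ 4 * (Nat.sqrt n * Nat.sqrt n) := by nlinarith
  calc C * n ≤ C * (4 * (Nat.sqrt n * Nat.sqrt n)) := Nat.mul_le_mul_left _ (by omega)
    _ = (4 * C) * (Nat.sqrt n * Nat.sqrt n) := by ring
    _ ≤ (c * c) * (Nat.sqrt n * Nat.sqrt n) := Nat.mul_le_mul_right _ hc
    _ = (c * Nat.sqrt n) * (c * Nat.sqrt n) := by ring

end Summit.ValiantsHypothesis.ValiantsHypothesis.Theorems.GrenetZeon.Ceilings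

end
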